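import Summits.BirchSwinnertonDyer.Rank1Residual.Additive.X3BranchDegenerateCount
import Summits.BirchSwinnertonDyer.Rank1Residual.X2.GreenbergVatsalUnramifiedAway
import Literature.NumberTheory.EllipticCurves.H1TrivialAction
import Literature.NumberTheory.EllipticCurves.H1UnramifiedFinite
import Literature.NumberTheory.GaloisRepresentations.ArtinLFunctionDirichletProofs
import Literature.NumberTheory.GaloisRepresentations.CyclotomicCharacterReductionProofs
import Literature.NumberTheory.Automorphic.CDTTheorem722SerreLevelProofs
import HarnessLib

/-!
# X3, the DEGENERATE rows: a LOWER BOUND for `#H¹(ℚ_Σ/ℚ_∞, Φ₀)` (trivial line) from EXHIBITED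
# classes — the order-`p` sub-characters of the mod-`ℓ` cyclotomic characters, `ℓ ∈ Σ₀`,
# `ℓ ≡ 1 (mod p)` (cell `bsd-eis`, seat `bsd-eis-x3` gen 6; consumer:
# `X3BranchDegenerateEndStateCardGe.lean` (`hnge`); route K1 `AdditiveBranchIMC`, crux
# `GordTwoRankZeroOffCaseOne` — supports only)

HONEST FRAMING (cell `bsd-eis`, `run/shared/lean/pub/bsd-eis/README.md` §4): the programme's target of
record is the full Birch–Swinnerton-Dyer formula for every `E/ℚ` of analytic rank `≤ 1`; this file
concerns the DEGENERATE X3 rows (`Φ₀ ≤ W[p]` a rational line with TRIVIAL `Γ_ℚ`-action: a rational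
point of order `p`; at `p = 3` the 1 381 rank-`0` (G-ord, `e = 2`) residue classes of referee A's
state 16a6b5d318458b9f). THEOREMS ONLY (no `def`, no named fact, no `sorry`); nothing is booked; no
label, tier or count of record moves.

## What

The degenerate certificate road (`X3BranchDegenerateEndStateCardGe.lean`) needs, per pair and for
the cyclotomic `κ`, a LOWER BOUND `p^{n+Σδ+1} ≤ #H¹(ℚ_Σ/ℚ_∞, Φ₀)·#U(W[p]/Φ₀)`. This file supplies the
first factor's share: for every finite set `T` of primes `ℓ ≡ 1 (mod p)` lying under places of
`Σ₀`, **`p^{#T} ≤ #H¹(ℚ_Σ/ℚ_∞, Φ₀)`** (`X3Branch.pow_card_le_natCard_residualLineH1_of_trivialLine`,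
§3) — PROVED by exhibiting classes, with no class-field theory: for `ℓ ∈ T` let
`χ_ℓ : Γ_ℚ → 𝔽_ℓˣ → Φ₀` be the mod-`ℓ` cyclotomic character followed by the homomorphism of the cyclic
group `𝔽_ℓˣ` sending a generator to a fixed `x₀ ∈ Φ₀` of order `p` (`p ∣ ℓ − 1`); `χ_ℓ` is a
continuous additive character, unramified outside `ℓ` (the tree's
`modNCyclotomicCharacter_eq_one_of_mem_inertia`) and equal to `x₀` on some inertia element `τ_ℓ`
at `ℓ` (the tree's `exists_mem_inertia_modNCyclotomicCharacter_eq`: `χ_ℓ(I_ℓ) = 𝔽_ℓˣ`); its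
restriction to `G_{ℚ_∞} = ker κ` is a class of `H¹(ℚ_Σ/ℚ_∞, Φ₀)` (conjugation-invariant, unramified
at every `v ∉ Σ₀`); `τ_ℓ ∈ G_{ℚ_∞}` (the cyclotomic tower is unramified at `ℓ ≠ p`, the tree's
`inertia_le_kerSubgroup_of_isCyclotomic`) and `χ_{ℓ'}(τ_ℓ) = 0` for `ℓ' ≠ ℓ`, so the classes are
independent: `k ↦ Σ k_ℓ χ_ℓ`, `k ∈ 𝔽_p^T`, injects (for a TRIVIAL action `H¹ = Hom`, the tree's
`H1TrivialAction`). This is the `ℓ ≡ 1 (mod p)` part of the count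
`#H¹(ℚ_Σ/ℚ_∞, 𝔽_p) = p^{Σ_{ℓ∈Σ₀, ℓ≡1(p)} s_ℓ}` (x3-MEMO-2 D3; `s_ℓ` = number of primes of `ℚ_∞`
above `ℓ`), which it EXHAUSTS when every `s_ℓ = 1` (at `p = 3`: `ℓ ≢ ±1 (mod 9)`; 785 of the 1 381
classes).

* §1 (generic: number field `K`, normal `H ≤ Γ_K`, discrete `Φ` with TRIVIAL action; namespace
  `TrivialLineClasses`): `exists_class_of_addChar`, `conjH1_eq_self_of_addChar`,
  `mem_unramified{Ker,Outside}_of_addChar`, `cocycleOf_{add,nsmul,sum}_apply`,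
  `pow_card_le_natCard_of_classes`; §2 (`K = ℚ`): `exists_addChar_cyclotomic_sub`;
  §3: `residualLine_smul_eq_self`, `exists_addOrderOf_eq_residualLine`, the main theorem.

References: [GreenbergVatsal2000] §2 pp. 16–17, 23, 28–30; [Washington1997] Prop. 2.3, §13.1;
[SerreGaloisCohomology1997] I.§2.3–2.5; [NeukirchANT1999] Ch. II (9.6); cell files x3-MEMO-{2,3}.md. -/

set_option autoImplicit false

noncomputable section
open scoped Classical AddSubgroup

namespace Summit.BirchSwinnertonDyer.Rank1Residual.Additive

open NumberField IsDedekindDomain Field WeierstrassCurve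
  Literature.NumberTheory.GaloisRepresentations
  Literature.NumberTheory.EllipticCurves
  Literature.NumberTheory.EllipticCurves.GreenbergSelmer
  Literature.NumberTheory.EllipticCurves.GreenbergVatsal2000
  Literature.NumberTheory.EllipticCurves.Rank1Residual

universe u

/-! ### §1 Generic: classes of `H¹(H, Φ)` from additive characters of `Γ_K` (trivial action) -/

namespace TrivialLineClasses

section Generic

variable {K : Type u} [Field K] [NumberField K] (H : Subgroup (absoluteGaloisGroup K)) [H.Normal]
  {Φ : Type u} [AddCommGroup Φ] [DistribMulAction (absoluteGaloisGroup K) Φ]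
  [TopologicalSpace Φ] [DiscreteTopology Φ]

omit [NumberField K] [H.Normal] [TopologicalSpace Φ] [DiscreteTopology Φ] in
/-- For a `Γ_K`-module with TRIVIAL action, the restricted action of a subgroup is trivial.
[folklore] -/
theorem subgroup_smul_eq_self_of_trivial (htriv : ∀ (σ : absoluteGaloisGroup K) (x : Φ), σ • x = x)
    (h : H) (x : Φ) : h • x = x := by
  rw [Subgroup.smul_def]; exact htriv _ _

omit [NumberField K] [H.Normal] in
/-- **The class `[χ|_H] ∈ H¹(H, Φ)` of a continuous additive character `χ : Γ_K → Φ`** (trivial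
action): stated as an existence with its defining property through `cocycleOf` (the unique cocycle
of a class, `H1TrivialAction`), so that no definition is introduced. [folklore] -/
theorem exists_class_of_addChar (htriv : ∀ (σ : absoluteGaloisGroup K) (x : Φ), σ • x = x)
    (χ : absoluteGaloisGroup K → Φ) (hχ : ∀ a b, χ (a * b) = χ a + χ b) (hc : Continuous χ) :
    ∃ c : subgroupH1 H Φ, ∀ h : H,
      (cocycleOf H Φ (subgroup_smul_eq_self_of_trivial H htriv) c).1 h = χ h := by
  have htrivH := subgroup_smul_eq_self_of_trivial H htriv
  refine ⟨oneCocycleClass (discreteTopRep H Φ)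
    (homCocycle htrivH (fun h : H ↦ χ h) (fun a b ↦ by rw [Subgroup.coe_mul, hχ])
      (hc.comp continuous_subtype_val)), fun h ↦ ?_⟩
  rw [cocycleOf_oneCocycleClass]
  rfl

omit [NumberField K] in
/-- **Conjugation acts trivially on the class of a character**: for `χ` additive on `Γ_K` with
values in a trivial module, `conj_σ [χ|_H] = [χ|_H]` (`(σ·χ)(h) = σ • χ(σ⁻¹ h σ) = χ(h)`). [folklore] -/
theorem conjH1_eq_self_of_addChar (htriv : ∀ (σ : absoluteGaloisGroup K) (x : Φ), σ • x = x)
    (χ : absoluteGaloisGroup K → Φ) (hχ : ∀ a b, χ (a * b) = χ a + χ b)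
    (c : subgroupH1 H Φ)
    (hcχ : ∀ h : H, (cocycleOf H Φ (subgroup_smul_eq_self_of_trivial H htriv) c).1 h = χ h)
    (σ : absoluteGaloisGroup K) : conjH1 H Φ σ c = c := by
  have htrivH := subgroup_smul_eq_self_of_trivial H htriv
  set f := cocycleOf H Φ htrivH c with hf
  have hc : c = oneCocycleClass (discreteTopRep H Φ) f := (oneCocycleClass_cocycleOf htrivH c).symm
  rw [hc]
  change resH1Hom (subgroupConj H σ) (DistribSMul.toAddMonoidHom Φ σ) _
    (oneCocycleClass (discreteTopRep H Φ) f) = _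
  unfold resH1Hom
  change (ContinuousCohomology.map (subgroupConj H σ) _ 1).hom (oneCocycleClass (discreteTopRep H Φ) f) = _
  rw [map_oneCocycleClass]
  congr 1
  refine Subtype.ext (ContinuousMap.ext fun h ↦ ?_)
  rw [contOneCocycles.pullback_apply]
  change σ • f.1 (subgroupConj H σ h) = f.1 h
  rw [htriv, hcχ, hcχ, subgroupConj_apply_coe, hχ, hχ, map_inv_eq_neg_of_map_mul' hχ]
  abel


omit [H.Normal] in
/-- **A character class vanishing on `I_v` is unramified at `v`**: if `χ` vanishes on the inertia
group `I_v ≤ Γ_K` of the chosen place above `v`, then `[χ|_H] ∈ ker(H¹(H, Φ) → H¹(H ⊓ I_v, Φ))`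
(`unramifiedKer`; the pulled-back cocycle is identically zero). [folklore] -/
theorem mem_unramifiedKer_of_addChar (htriv : ∀ (σ : absoluteGaloisGroup K) (x : Φ), σ • x = x)
    (χ : absoluteGaloisGroup K → Φ) (c : subgroupH1 H Φ)
    (hcχ : ∀ h : H, (cocycleOf H Φ (subgroup_smul_eq_self_of_trivial H htriv) c).1 h = χ h)
    (v : HeightOneSpectrum (𝓞 K)) (hv : ∀ τ ∈ inertia v, χ τ = 0) :
    c ∈ GreenbergVatsal2000.unramifiedKer H Φ v := by
  have htrivH := subgroup_smul_eq_self_of_trivial H htriv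
  set f := cocycleOf H Φ htrivH c with hf
  have hc : c = oneCocycleClass (discreteTopRep H Φ) f := (oneCocycleClass_cocycleOf htrivH c).symm
  rw [GreenbergVatsal2000.unramifiedKer, hc, ← resKer_eq_ker, oneCocycleClass_mem_resKer_iff]
  refine ⟨0, fun x ↦ ?_⟩
  rw [smul_zero, sub_zero, AddMonoidHom.id_apply, hcχ]
  exact hv _ ((mem_inertiaIn_iff H v x.1).1 x.2).2

/-- **A character class unramified away from `S₀ ∪ {p}` lies in `H¹(ℚ_Σ/ℚ_∞, Φ)`**
(`unramifiedOutside H Φ p S₀`): conjugation fixes the class (`conjH1_eq_self_of_addChar`) and at each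
finite `v ∉ S₀`, `v ∤ p`, the character vanishes on `I_v`. [cite: GreenbergVatsal2000, §2 pp. 16, 23, 28] -/
theorem mem_unramifiedOutside_of_addChar (htriv : ∀ (σ : absoluteGaloisGroup K) (x : Φ), σ • x = x)
    (χ : absoluteGaloisGroup K → Φ) (hχ : ∀ a b, χ (a * b) = χ a + χ b) (c : subgroupH1 H Φ)
    (hcχ : ∀ h : H, (cocycleOf H Φ (subgroup_smul_eq_self_of_trivial H htriv) c).1 h = χ h)
    (p : ℕ) (S₀ : Set (HeightOneSpectrum (𝓞 K)))
    (hv : ∀ v : HeightOneSpectrum (𝓞 K), v ∉ S₀ → ((p : ℕ) : 𝓞 K) ∉ v.asIdeal →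
      ∀ τ ∈ inertia v, χ τ = 0) :
    c ∈ unramifiedOutside H Φ p S₀ := by
  rw [mem_unramifiedOutside_iff]
  intro v hvS hvp σ
  rw [conjH1_eq_self_of_addChar H htriv χ hχ c hcχ σ]
  exact mem_unramifiedKer_of_addChar H htriv χ c hcχ v (hv v hvS hvp)

omit [NumberField K] [H.Normal] in
/-- Evaluation at `τ ∈ H` is additive on `H¹(H, Φ)` (trivial action, `cocycleOf_add`). [folklore] -/
theorem cocycleOf_add_apply (htrivH : ∀ (h : H) (x : Φ), h • x = x) (c c' : subgroupH1 H Φ) (τ : H) :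
    (cocycleOf H Φ htrivH (c + c')).1 τ = (cocycleOf H Φ htrivH c).1 τ + (cocycleOf H Φ htrivH c').1 τ := by
  rw [cocycleOf_add]; rfl

omit [NumberField K] [H.Normal] in
/-- `cocycleOf` of a natural multiple, evaluated. [folklore] -/
theorem cocycleOf_nsmul_apply (htrivH : ∀ (h : H) (x : Φ), h • x = x) (n : ℕ) (c : subgroupH1 H Φ)
    (τ : H) : (cocycleOf H Φ htrivH (n • c)).1 τ = n • (cocycleOf H Φ htrivH c).1 τ := by
  induction n with
  | zero =>
    have h0 : cocycleOf H Φ htrivH 0 = 0 := map_zero (classEquivOfTrivial H Φ htrivH).symm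
    rw [zero_nsmul, zero_nsmul, h0]; rfl
  | succ n ih => rw [succ_nsmul, succ_nsmul, cocycleOf_add_apply, ih]

omit [NumberField K] [H.Normal] in
/-- `cocycleOf` of a finite sum, evaluated. [folklore] -/
theorem cocycleOf_sum_apply (htrivH : ∀ (h : H) (x : Φ), h • x = x) {ι : Type*} (s : Finset ι)
    (c : ι → subgroupH1 H Φ) (τ : H) :
    (cocycleOf H Φ htrivH (∑ i ∈ s, c i)).1 τ = ∑ i ∈ s, (cocycleOf H Φ htrivH (c i)).1 τ := by
  induction s using Finset.cons_induction with
  | empty =>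
    have h0 : cocycleOf H Φ htrivH 0 = 0 := map_zero (classEquivOfTrivial H Φ htrivH).symm
    rw [Finset.sum_empty, Finset.sum_empty, h0]; rfl
  | cons a s ha ih => rw [Finset.sum_cons, Finset.sum_cons, cocycleOf_add_apply, ih]

omit [NumberField K] [H.Normal] in
/-- **Counting exhibited classes.** Let `X ≤ H¹(H, Φ)` be finite, `c : ι → X` classes and
`τ : ι → H` test elements with `cocycle(c i)(τ j) = 0` for `i ≠ j` and `cocycle(c i)(τ i)` of additive
order `p` (a prime). Then `k ↦ Σ k_i • c_i`, `k : ι → ZMod p`, is injective, so `p^{#ι} ≤ #X`.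
[folklore] -/
theorem pow_card_le_natCard_of_classes (htrivH : ∀ (h : H) (x : Φ), h • x = x) {p : ℕ}
    [Fact p.Prime] (X : AddSubgroup (subgroupH1 H Φ)) [Finite X] {ι : Type} [Fintype ι]
    (c : ι → subgroupH1 H Φ) (hc : ∀ i, c i ∈ X) (τ : ι → H)
    (hoff : ∀ i j, i ≠ j → (cocycleOf H Φ htrivH (c i)).1 (τ j) = 0)
    (hdiag : ∀ i, addOrderOf ((cocycleOf H Φ htrivH (c i)).1 (τ i)) = p) :
    p ^ Fintype.card ι ≤ Nat.card X := by
  let F : (ι → ZMod p) → X := fun k ↦ ⟨∑ i, (k i).val • c i,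
    X.sum_mem fun i _ ↦ X.nsmul_mem (hc i) _⟩
  have heval : ∀ k : ι → ZMod p, ∀ j,
      (cocycleOf H Φ htrivH (∑ i, (k i).val • c i)).1 (τ j) =
        (k j).val • (cocycleOf H Φ htrivH (c j)).1 (τ j) := fun k j ↦ by
    rw [cocycleOf_sum_apply H htrivH Finset.univ (fun i ↦ (k i).val • c i) (τ j)]
    rw [Finset.sum_eq_single j (fun i _ hij ↦ by
        rw [cocycleOf_nsmul_apply H htrivH, hoff i j hij, nsmul_zero])
      (fun h ↦ absurd (Finset.mem_univ j) h)]
    exact cocycleOf_nsmul_apply H htrivH _ _ _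
  have hF : Function.Injective F := by
    intro k k' hkk'
    have hsum : (∑ i, (k i).val • c i) = ∑ i, (k' i).val • c i := congrArg Subtype.val hkk'
    funext j
    have hj := congrArg (fun z : subgroupH1 H Φ ↦ (cocycleOf H Φ htrivH z).1 (τ j)) hsum
    simp only at hj
    rw [heval k j, heval k' j] at hj
    have hmod := nsmul_inj_mod.mp hj
    rw [hdiag j, Nat.mod_eq_of_lt (ZMod.val_lt _), Nat.mod_eq_of_lt (ZMod.val_lt _)] at hmod
    exact ZMod.val_injective p hmod
  have h := Nat.card_le_card_of_injective F hF
  rwa [Nat.card_fun, Nat.card_zmod, Nat.card_eq_fintype_card] at h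

end Generic


/-! ### §2 Over `ℚ`: the order-`p` sub-character of the mod-`ℓ` cyclotomic character -/

section Characters

variable {p : ℕ} {Φ : Type} [AddCommGroup Φ] [TopologicalSpace Φ]

/-- **The order-`p` sub-character of `χ_ℓ`.** For primes `ℓ` with `p ∣ ℓ − 1` and `x₀ ∈ Φ` of
additive order `p`, there is a continuous additive character `χ : Γ_ℚ → Φ` — `χ = q ∘ χ_ℓ`,
`χ_ℓ : Γ_ℚ → 𝔽_ℓˣ` the mod-`ℓ` cyclotomic character, `q : 𝔽_ℓˣ → Φ` the homomorphism of the
cyclic group `𝔽_ℓˣ` sending a generator to `x₀` — which (i) vanishes on the inertia group `I_v` of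
every finite `v ∤ ℓ` (`χ_ℓ` is unramified outside `ℓ`) and (ii) takes the value `x₀` on some element
of the inertia group at `ℓ` (`χ_ℓ(I_ℓ) = 𝔽_ℓˣ`: `ℚ(ζ_ℓ)` is totally ramified at `ℓ`). This is the
order-`p` subfield of `ℚ(ζ_ℓ)` seen through `Φ`.
[cite: Washington1997, Prop. 2.3 (ramification in ℚ(ζ_n)); Lemma 1.4] -/
theorem exists_addChar_cyclotomic_sub (ℓ : ℕ) (hℓ : ℓ.Prime) (hpℓ : p ∣ ℓ - 1)
    (x₀ : Φ) (hx₀ : addOrderOf x₀ = p)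
    (vℓ : HeightOneSpectrum (𝓞 ℚ)) (hvℓ : ((ℓ : ℕ) : 𝓞 ℚ) ∈ vℓ.asIdeal) :
    ∃ χ : absoluteGaloisGroup ℚ → Φ, (∀ a b, χ (a * b) = χ a + χ b) ∧ Continuous χ ∧
      (∀ v : HeightOneSpectrum (𝓞 ℚ), ((ℓ : ℕ) : 𝓞 ℚ) ∉ v.asIdeal → ∀ τ ∈ inertia v, χ τ = 0) ∧
      ∃ τ ∈ inertia vℓ, χ τ = x₀ := by
  haveI : Fact ℓ.Prime := ⟨hℓ⟩
  haveI : NeZero ℓ := ⟨hℓ.ne_zero⟩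
  haveI : NeZero ((ℓ : ℕ) : ℚ) := ⟨by exact_mod_cast hℓ.ne_zero⟩
  -- a generator `g` of `𝔽_ℓˣ` and the homomorphism `q : 𝔽_ℓˣ → Multiplicative Φ`, `g ↦ x₀`
  obtain ⟨g, hg⟩ := IsCyclic.exists_generator (α := (ZMod ℓ)ˣ)
  have hordg : orderOf g = ℓ - 1 := by
    rw [orderOf_eq_card_of_forall_mem_zpowers hg, Nat.card_eq_fintype_card, ZMod.card_units]
  have hord' : orderOf (Multiplicative.ofAdd x₀) ∣ orderOf g := by
    rw [orderOf_ofAdd_eq_addOrderOf, hx₀, hordg]; exact hpℓ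
  set q : (ZMod ℓ)ˣ →* Multiplicative Φ := monoidHomOfForallMemZpowers hg hord' with hq
  have hqg : q g = Multiplicative.ofAdd x₀ := monoidHomOfForallMemZpowers_apply_gen hg hord'
  set χ : absoluteGaloisGroup ℚ → Φ :=
    fun σ ↦ Multiplicative.toAdd (q (modNCyclotomicCharacter ℚ ℓ σ)) with hχdef
  have hχ : ∀ a b, χ (a * b) = χ a + χ b := fun a b ↦ by
    simp only [hχdef, map_mul, toAdd_mul]
  have hχ1 : ∀ σ, modNCyclotomicCharacter ℚ ℓ σ = 1 → χ σ = 0 := fun σ h ↦ by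
    simp only [hχdef, h, map_one, toAdd_one]
  -- continuity: `χ` vanishes on the open kernel of `χ_ℓ`
  have hcont : Continuous χ := by
    obtain ⟨U, hU, hUo, h1U⟩ := mem_nhds_iff.mp (modNCyclotomicCharacter_eventually_eq_one ℚ ℓ)
    exact continuous_of_map_mul_of_forall_mem_eq_zero hχ U hUo h1U fun u hu ↦ hχ1 u (hU hu)
  refine ⟨χ, hχ, hcont, fun v hv τ hτ ↦ hχ1 τ ?_, ?_⟩
  · -- (i) unramified at `v ∤ ℓ`
    haveI := (adicCompletionPrime_mem_primesAbove ℚ v).1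
    have hτ' : τ ∈ (adicCompletionPrime ℚ v).inertia (absoluteGaloisGroup ℚ) := by
      rw [inertia_adicCompletionPrime_eq_map_absInertia]; exact hτ
    exact modNCyclotomicCharacter_eq_one_of_mem_inertia
      (absIntegers.natCast_notMem_of_mem_primesAbove hv (adicCompletionPrime_mem_primesAbove ℚ v)) hτ'
  · -- (ii) an inertia element at `ℓ` with `χ_ℓ(τ) = g`
    have hgen : Rat.HeightOneSpectrum.natGenerator vℓ = ℓ :=
      (Literature.NumberTheory.Automorphic.BCDT.natCast_mem_asIdeal_iff_primesEquiv_eq vℓ hℓ).mp hvℓ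
    obtain ⟨τ, hτI, hτg⟩ := exists_mem_inertia_modNCyclotomicCharacter_eq (m := ℓ) (p := ℓ)
      (k := 0) (d := 1) (by rw [zero_add, pow_one, mul_one])
      (fun h1 ↦ hℓ.one_lt.ne' (Nat.dvd_one.mp h1)) hgen (adicCompletionPrime_mem_primesAbove ℚ vℓ)
      (a := g) (Subsingleton.elim _ _)
    refine ⟨τ, ?_, ?_⟩
    · change τ ∈ (absInertia (vℓ.adicCompletion ℚ)).map _
      rw [← inertia_adicCompletionPrime_eq_map_absInertia]; exact hτI
    · simp only [hχdef, hτg, hqg, toAdd_ofAdd]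

end Characters

end TrivialLineClasses


/-! ### §3 The LOWER BOUND `p^{#T} ≤ #H¹(ℚ_Σ/ℚ_∞, Φ₀)` for the TRIVIAL line -/

section Main

open TrivialLineClasses

variable {p : ℕ} [hp : Fact p.Prime] {W : WeierstrassCurve ℚ}

/-- The `Γ_ℚ`-action on GV's residual line `Φ` is TRIVIAL when `Φ₀` is fixed pointwise (the
degenerate rows: a rational point of order `p`). [cite: GreenbergVatsal2000, §2 p. 28] -/
theorem residualLine_smul_eq_self {Φ₀ : AddSubgroup (W.geomTorsion (p : ℤ))}
    (hΦ : IsRationalLine W p Φ₀)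
    (htriv : ∀ (σ : absoluteGaloisGroup ℚ) (P : geomTorsion W (p : ℤ)), P ∈ Φ₀ → σ • P = P)
    (σ : absoluteGaloisGroup ℚ) (x : (residualLine Φ₀ hΦ).Sub) : σ • x = x := by
  obtain ⟨y, hy⟩ := x
  obtain ⟨P, hP, rfl⟩ := hy
  apply Subtype.ext
  change σ • torsionToPrimary W p P = torsionToPrimary W p P
  conv_rhs => rw [← htriv σ P hP]
  rfl

/-- GV's residual line `Φ` (order `p`) has an element of additive order `p`.
[cite: GreenbergVatsal2000, §2 p. 28] -/
theorem exists_addOrderOf_eq_residualLine {Φ₀ : AddSubgroup (W.geomTorsion (p : ℤ))}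
    (hΦ : IsRationalLine W p Φ₀) :
    ∃ x : (residualLine Φ₀ hΦ).Sub, addOrderOf x = p := by
  have hcard : Nat.card Φ₀ = p := hΦ.1
  haveI : Finite Φ₀ := Nat.finite_of_card_ne_zero (by rw [hcard]; exact hp.out.ne_zero)
  haveI : Nontrivial Φ₀ := Finite.one_lt_card_iff_nontrivial.mp (by rw [hcard]; exact hp.out.one_lt)
  obtain ⟨P, hP0⟩ := exists_ne (0 : Φ₀)
  have hpP : p • ((P : geomTorsion W (p : ℤ)) : W.geomPoints) = 0 :=
    AddSubgroup.torsionBy.nsmul_iff.mp (P : geomTorsion W (p : ℤ)).2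
  set x : (residualLine Φ₀ hΦ).Sub := ⟨torsionToPrimary W p P, ⟨P, P.2, rfl⟩⟩ with hx
  have hx0 : x ≠ 0 := by
    intro h
    apply hP0
    have h1 : (((torsionToPrimary W p P : ↥((↥(W.geomPrimaryTorsion p))[(p : ℤ)])) :
        W.geomPrimaryTorsion p) : W.geomPoints) = 0 :=
      congrArg (fun z : (residualLine Φ₀ hΦ).Sub ↦
        (((z.1 : ↥((↥(W.geomPrimaryTorsion p))[(p : ℤ)])) : W.geomPrimaryTorsion p) : W.geomPoints)) h
    exact Subtype.ext (Subtype.ext h1)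
  have hpx : p • x = 0 := by
    apply Subtype.ext; apply Subtype.ext; apply Subtype.ext
    change p • ((P : geomTorsion W (p : ℤ)) : W.geomPoints) = 0
    exact hpP
  exact ⟨x, addOrderOf_eq_prime hpx hx0⟩

/-- **LOWER BOUND for `#H¹(ℚ_Σ/ℚ_∞, Φ₀)` on the DEGENERATE rows (trivial line) from EXHIBITED
classes.** `κ` the cyclotomic `ℤ_p`-extension, `Σ = Σ₀ ∪ {p, ∞}` with `Σ₀ ∌ p`, `Φ₀ ≤ W[p]` a
rational line fixed pointwise by `Γ_ℚ`. For every finite set `T` of primes `ℓ ≡ 1 (mod p)` lying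
UNDER places of `Σ₀`: `p^{#T} ≤ #H¹(ℚ_Σ/ℚ_∞, Φ₀)` (`residualLineH1`, assumed finite). The classes:
the restrictions to `G_{ℚ_∞}` of the order-`p` sub-characters of the mod-`ℓ` cyclotomic characters
`χ_ℓ`, `ℓ ∈ T` (§2), valued in `Φ₀`; unramified outside `ℓ`; independent because `χ_ℓ` is non-trivial
on an inertia element `τ_ℓ` at `ℓ`, which lies in `G_{ℚ_∞}` (the cyclotomic tower is unramified at
`ℓ ≠ p`) and on which every `χ_{ℓ'}`, `ℓ' ≠ ℓ`, vanishes.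
[cite: GreenbergVatsal2000, §2 pp. 28–30] [cite: Washington1997, Prop. 2.3, §13.1] -/
theorem X3Branch.pow_card_le_natCard_residualLineH1_of_trivialLine (κ : ZpExtension ℚ p)
    (hκ : κ.IsCyclotomic) (S₀ : Finset (HeightOneSpectrum (𝓞 ℚ)))
    (hS₀ : ∀ v ∈ S₀, ((p : ℕ) : 𝓞 ℚ) ∉ v.asIdeal)
    {Φ₀ : AddSubgroup (W.geomTorsion (p : ℤ))} (hΦ : IsRationalLine W p Φ₀)
    (htriv : ∀ (σ : absoluteGaloisGroup ℚ) (P : geomTorsion W (p : ℤ)), P ∈ Φ₀ → σ • P = P)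
    (T : Finset ℕ) (hT : ∀ ℓ ∈ T, ℓ.Prime ∧ p ∣ ℓ - 1 ∧ ∃ v ∈ S₀, ((ℓ : ℕ) : 𝓞 ℚ) ∈ v.asIdeal)
    [Finite (residualLineH1 W p κ S₀ Φ₀ hΦ)] :
    p ^ T.card ≤ Nat.card (residualLineH1 W p κ S₀ Φ₀ hΦ) := by
  have htrivΦ := residualLine_smul_eq_self hΦ htriv
  have htrivH := subgroup_smul_eq_self_of_trivial κ.kerSubgroup htrivΦ
  obtain ⟨x₀, hx₀⟩ := exists_addOrderOf_eq_residualLine (p := p) (W := W) hΦ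
  -- the places `v_ℓ ∈ Σ₀` under which the primes of `T` lie
  choose vOf hvOfS hvOf using fun ℓ : T ↦ (hT ℓ ℓ.2).2.2
  -- uniqueness of the place of `ℚ` above a rational prime
  have huniq : ∀ (ℓ : ℕ), ℓ.Prime → ∀ v w : HeightOneSpectrum (𝓞 ℚ),
      ((ℓ : ℕ) : 𝓞 ℚ) ∈ v.asIdeal → ((ℓ : ℕ) : 𝓞 ℚ) ∈ w.asIdeal → v = w := fun ℓ hℓ v w hv hw ↦ by
    have h1 := (Literature.NumberTheory.Automorphic.BCDT.natCast_mem_asIdeal_iff_primesEquiv_eq v hℓ).mp hv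
    have h2 := (Literature.NumberTheory.Automorphic.BCDT.natCast_mem_asIdeal_iff_primesEquiv_eq w hℓ).mp hw
    exact Rat.HeightOneSpectrum.primesEquiv.injective (Subtype.ext (h1.trans h2.symm))
  -- the characters `χ_ℓ` and the inertia elements `τ_ℓ`
  choose χ hχadd hχcont hχunr τ hτI hχτ using fun ℓ : T ↦
    exists_addChar_cyclotomic_sub (p := p) (Φ := (residualLine Φ₀ hΦ).Sub) ℓ.1 (hT ℓ ℓ.2).1
      (hT ℓ ℓ.2).2.1 x₀ hx₀ (vOf ℓ) (hvOf ℓ)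
  -- their classes in `H¹(G_{ℚ_∞}, Φ)`
  choose c hc using fun ℓ : T ↦
    exists_class_of_addChar κ.kerSubgroup htrivΦ (χ ℓ) (hχadd ℓ) (hχcont ℓ)
  -- `τ_ℓ ∈ G_{ℚ_∞}`: the cyclotomic tower is unramified at `ℓ ≠ p`
  have hτH : ∀ ℓ : T, τ ℓ ∈ κ.kerSubgroup := fun ℓ ↦
    X2.GreenbergVatsalUnramifiedAway.inertia_le_kerSubgroup_of_isCyclotomic κ (vOf ℓ) hκ
      (hS₀ _ (hvOfS ℓ)) (hτI ℓ)
  refine le_of_eq_of_le (by rw [Fintype.card_coe]) (pow_card_le_natCard_of_classes κ.kerSubgroup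
    htrivH (residualLineH1 W p κ S₀ Φ₀ hΦ) c (fun ℓ ↦ ?_) (fun ℓ ↦ ⟨τ ℓ, hτH ℓ⟩)
    (fun i j hij ↦ ?_) (fun i ↦ ?_))
  · -- membership in `H¹(ℚ_Σ/ℚ_∞, Φ)`: `χ_ℓ` is unramified at every `v ∉ Σ₀`
    refine mem_unramifiedOutside_of_addChar κ.kerSubgroup htrivΦ (χ ℓ) (hχadd ℓ) (c ℓ) (hc ℓ) p
      (↑S₀) fun v hvS _ ↦ hχunr ℓ v fun hv ↦ hvS ?_
    rw [huniq ℓ.1 (hT ℓ ℓ.2).1 v (vOf ℓ) hv (hvOf ℓ)]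
    exact hvOfS ℓ
  · -- off-diagonal vanishing: `τ_j ∈ I_{v_j}` and `ℓ_i ∤ v_j`
    rw [hc i ⟨τ j, hτH j⟩]
    refine hχunr i (vOf j) (fun hmem ↦ hij (Subtype.ext ?_)) (τ j) (hτI j)
    have := huniq i.1 (hT i i.2).1 (vOf j) (vOf i) hmem (hvOf i)
    have h1 := (Literature.NumberTheory.Automorphic.BCDT.natCast_mem_asIdeal_iff_primesEquiv_eq
      (vOf j) (hT j j.2).1).mp (hvOf j)
    have h2 := (Literature.NumberTheory.Automorphic.BCDT.natCast_mem_asIdeal_iff_primesEquiv_eq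
      (vOf j) (hT i i.2).1).mp hmem
    exact h2.symm.trans h1 ▸ rfl
  · -- diagonal: `χ_i(τ_i) = x₀` has order `p`
    rw [hc i ⟨τ i, hτH i⟩]
    change addOrderOf (χ i (τ i)) = p
    rw [hχτ i]; exact hx₀

end Main

end Summit.BirchSwinnertonDyer.Rank1Residual.Additive
end
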